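import Summits.Ventures.HSemireg.WedgeHankelPairGradingMaps
import Summits.Ventures.HSemireg.WedgeHankelPairMixingDet

/-!
# Venture HSemireg — EVERY KERNEL AND EVERY IMAGE OF TH-7's CLASS IS STABLE UNDER THE FULL MATRIX MONOID `M_n(K)` OF PAIR MIXINGS, SINGULAR `M` INCLUDED:
# the torus acts on ANY form by its weight decomposition `Pm (diagonal d) θ = Σ_τ (Π_c d_c^{τ_c})·proj_τ θ` (every `d`, zeros allowed), H10's grading puts each piece back in the
# kernel, and Mathlib's transvection–diagonal factorization does the rest

HONEST FRAMING. Part of the Lean index of the computation cell `pub-hsemireg` (seat p10 gen 19, Sunday typer «UNIFORM-IN-n»).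
Finite-dimensional EXTERIOR ALGEBRA over a field ONLY: no variety, no cohomology theory, no sheaf, no Ext group, no semiregularity map;
nothing here says that HC / HC_CM / HC_AV holds; no Literature fact is declared or used.  Custodian versions as in `WedgeHankelSiegelIdeal` (1/3); the dictionary (`Pm M` = a linear map of
the `n` factors applied to both letters of every pair; a singular `M` = a degeneration of the factors) is QUOTED, never asserted.

WHAT IS IN THE TREE.  H9b `WedgeHankelPairMixingDet` (924): for `det M ≠ 0`, `PmE hM` maps `Kr(univ, w_n q, k)` and `V(univ, w_n q, k)` ONTO themselves (`map_PmE_Kr_w`, `map_PmE_V_w` — via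
`Pm M (w_n q) = det M · w_n q`, which says nothing when `det M = 0`); H10 (923) + I2 `WedgeHankelPairGradingMaps` (942, this seat): kernels AND images are direct sums of their pair-type
components (`proj_ptype_mem_Kr`, `proj_ptype_mem_V`) and the torus acts on the `τ`-component by `Π_c d_c^{τ_c}` (`Pm_diagonal_proj_ptype`); I3 (this seat): `SI_k` is stable under every
`Pm M`.  THIS FILE does the kernels and images (namespace `Summit.Ventures.HSemireg.Wedge.HankelPairMixing` continued):
* §174 THE WEIGHT DECOMPOSITION OF ANY FORM: over the finite set `univ.image ptype` of pair types that occur, **`sum_proj_ptype_eq`: `Σ_τ proj_{ptype = τ} θ = θ`**, and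
  **`Pm_diagonal_eq_sum_proj`: `Pm (diagonal d) θ = Σ_τ (Π_c d_c^{τ_c}) · proj_{ptype = τ} θ`** for EVERY `d : Fin n → K` (zeros allowed) and every `θ`.
* §175 **`Pm_diagonal_mem_Kr` / `Pm_diagonal_mem_V`**: for a transversal `f`, every (possibly singular) diagonal pair scaling maps `Kr(univ, f, k)` and `V(univ, f, k)` into themselves.
* §176 **`Pm_mem_Kr_w` / `Pm_mem_V_w`: `θ ∈ Kr(univ, w_n q, k) ⇒ Pm M θ ∈ Kr(univ, w_n q, k)` and the same for `V`, for EVERY `M ∈ M_n(K)`**, every `q`, every `k`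
  (`Matrix.diagonal_transvection_induction`: transvections by H9b, diagonals by §175, products by `Pm_mul`); submodule forms `map_Pm_Kr_w_le` / `map_Pm_V_w_le`.  With I3
  (`SI_k`) and H1b (the letters' `Sb`): EVERY NAME IN THE KERNEL ATLAS IS STABLE UNDER THE MONOID `M₂(K) × M_n(K)`, not only under `GL₂ × GL_n`.
NOT typed here: the image `Pm M (Kr)` for singular `M` as a named subspace (it is the part of `Kr` supported on the pairs in the image of `M`, for a coordinate projection `M`); kernels of
NON-transversal classes (H10's grading needs transversality); anything Ext-side.  Class side only; new names only.
-/

open Module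

namespace Summit.Ventures.HSemireg.Wedge.HankelPairMixing

open Summit.Ventures.HSemireg.Wedge Summit.Ventures.HSemireg.Wedge.Kunneth Summit.Ventures.HSemireg.Wedge.Hankel
  Summit.Ventures.HSemireg.Wedge.KunnethKernel Summit.Ventures.HSemireg.Wedge.Weil Summit.Ventures.HSemireg.Wedge.HankelPairGrading

variable (K : Type*) [Field K] {N : ℕ}

/-! ## §174. The weight decomposition of any form under the torus -/

omit [Field K] in
/-- every support's pair type lies in the (finite) set `univ.image ptype` of pair types that occur. -/
lemma ptype_mem_image_ptype (s : Finset (In N)) : ptype s ∈ (Finset.univ : Finset (Finset (In N))).image ptype :=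
  Finset.mem_image_of_mem _ (Finset.mem_univ s)

/-- **THE PAIR-TYPE PROJECTIONS SUM TO THE IDENTITY: `Σ_{τ ∈ univ.image ptype} proj_{ptype = τ} θ = θ`** (checked on the monomial basis). -/
theorem sum_proj_ptype_eq (θ : HT K (In N)) : ∑ τ ∈ (Finset.univ : Finset (Finset (In N))).image ptype, proj (K := K) (fun s : Finset (In N) => ptype s = τ) θ = θ := by
  classical
  have h : (∑ τ ∈ (Finset.univ : Finset (Finset (In N))).image ptype, proj (K := K) (fun s : Finset (In N) => ptype s = τ)) = LinearMap.id := by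
    refine (B K (In N)).ext fun s => ?_
    rw [LinearMap.sum_apply, LinearMap.id_apply]
    simp_rw [proj_B]
    rw [Finset.sum_ite_eq ((Finset.univ : Finset (Finset (In N))).image ptype) (ptype s) (fun _ => B K (In N) s), if_pos (ptype_mem_image_ptype s)]
  have h' := LinearMap.congr_fun h θ
  rwa [LinearMap.sum_apply, LinearMap.id_apply] at h'

/-- **THE WEIGHT DECOMPOSITION: `Pm (diagonal d) θ = Σ_{τ ∈ univ.image ptype} (Π_c d_c^{τ_c}) · proj_{ptype = τ} θ`** for EVERY `d : Fin N → K` (zeros allowed) and every `θ`. -/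
theorem Pm_diagonal_eq_sum_proj (d : Fin N → K) (θ : HT K (In N)) :
    Pm K (Matrix.diagonal d) θ = ∑ τ ∈ (Finset.univ : Finset (Finset (In N))).image ptype, (∏ c, d c ^ τ c) • proj (K := K) (fun s : Finset (In N) => ptype s = τ) θ := by
  classical
  conv_lhs => rw [← sum_proj_ptype_eq K θ]
  rw [map_sum]
  exact Finset.sum_congr rfl fun τ _ => Pm_diagonal_proj_ptype K d τ θ

/-! ## §175. Diagonal pair scalings (singular included) preserve kernels and images of transversal classes -/

/-- **`θ ∈ Kr(univ, f, k) ⇒ Pm (diagonal d) θ ∈ Kr(univ, f, k)`** for a transversal `f` and EVERY `d` (H10: each pair-type component of `θ` lies in the kernel). -/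
theorem Pm_diagonal_mem_Kr (d : Fin N → K) {f : HT K (In N)} (hf : f ∈ Sp K (Tr (N := N))) {k : ℕ} {θ : HT K (In N)} (hθ : θ ∈ Kr K Finset.univ f k) :
    Pm K (Matrix.diagonal d) θ ∈ Kr K Finset.univ f k := by
  rw [Pm_diagonal_eq_sum_proj]
  exact Submodule.sum_mem _ fun τ _ => Submodule.smul_mem _ _ (proj_ptype_mem_Kr K τ hf hθ)

/-- **`v ∈ V(univ, f, k) ⇒ Pm (diagonal d) v ∈ V(univ, f, k)`** for a transversal `f` and EVERY `d` (I2: images are pair-graded). -/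
theorem Pm_diagonal_mem_V (d : Fin N → K) {f : HT K (In N)} (hf : f ∈ Sp K (Tr (N := N))) {k : ℕ} {v : HT K (In N)} (hv : v ∈ V K (In N) Finset.univ f k) :
    Pm K (Matrix.diagonal d) v ∈ V K (In N) Finset.univ f k := by
  rw [Pm_diagonal_eq_sum_proj]
  exact Submodule.sum_mem _ fun τ _ => Submodule.smul_mem _ _ (proj_ptype_mem_V K τ hf hv)

/-! ## §176. Every kernel and every image of th-7's class is stable under the full matrix monoid -/

/-- **EVERY KERNEL OF TH-7's CLASS IS `M_n(K)`-STABLE: `θ ∈ Kr(univ, w_N q, k) ⇒ Pm M θ ∈ Kr(univ, w_N q, k)` for EVERY matrix `M`** (singular included), every `q`, every `k` —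
transvections by H9b, (singular) diagonals by §175, products by `Pm_mul`. -/
theorem Pm_mem_Kr_w (M : Matrix (Fin N) (Fin N) K) (q : ℕ → K) {k : ℕ} {θ : HT K (In N)} (hθ : θ ∈ Kr K Finset.univ (w K N N q) k) :
    Pm K M θ ∈ Kr K Finset.univ (w K N N q) k := by
  have key : ∀ θ : HT K (In N), θ ∈ Kr K Finset.univ (w K N N q) k → Pm K M θ ∈ Kr K Finset.univ (w K N N q) k := by
    refine Matrix.diagonal_transvection_induction (P := fun M => ∀ θ : HT K (In N), θ ∈ Kr K Finset.univ (w K N N q) k → Pm K M θ ∈ Kr K Finset.univ (w K N N q) k) M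
      (fun d _ θ hθ => Pm_diagonal_mem_Kr K d (w_mem_Sp_Tr K q) hθ) (fun t θ hθ => ?_) (fun A B hA hB θ hθ => ?_)
    · have hdet : t.toMatrix.det ≠ 0 := by rw [Matrix.TransvectionStruct.det]; exact one_ne_zero
      rw [← map_PmE_Kr_w K hdet q k]
      exact ⟨θ, hθ, rfl⟩
    · rw [Pm_mul, AlgHom.comp_apply]
      exact hA _ (hB _ hθ)
  exact key θ hθ

/-- **EVERY IMAGE OF TH-7's CLASS IS `M_n(K)`-STABLE: `v ∈ V(univ, w_N q, k) ⇒ Pm M v ∈ V(univ, w_N q, k)` for EVERY `M`.** -/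
theorem Pm_mem_V_w (M : Matrix (Fin N) (Fin N) K) (q : ℕ → K) {k : ℕ} {v : HT K (In N)} (hv : v ∈ V K (In N) Finset.univ (w K N N q) k) :
    Pm K M v ∈ V K (In N) Finset.univ (w K N N q) k := by
  have key : ∀ v : HT K (In N), v ∈ V K (In N) Finset.univ (w K N N q) k → Pm K M v ∈ V K (In N) Finset.univ (w K N N q) k := by
    refine Matrix.diagonal_transvection_induction (P := fun M => ∀ v : HT K (In N), v ∈ V K (In N) Finset.univ (w K N N q) k → Pm K M v ∈ V K (In N) Finset.univ (w K N N q) k) M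
      (fun d _ v hv => Pm_diagonal_mem_V K d (w_mem_Sp_Tr K q) hv) (fun t v hv => ?_) (fun A B hA hB v hv => ?_)
    · have hdet : t.toMatrix.det ≠ 0 := by rw [Matrix.TransvectionStruct.det]; exact one_ne_zero
      rw [← map_PmE_V_w K hdet q k]
      exact ⟨v, hv, rfl⟩
    · rw [Pm_mul, AlgHom.comp_apply]
      exact hA _ (hB _ hv)
  exact key v hv

/-- submodule form: **`Pm M (Kr(univ, w_N q, k)) ≤ Kr(univ, w_N q, k)`** for every `M`. -/
theorem map_Pm_Kr_w_le (M : Matrix (Fin N) (Fin N) K) (q : ℕ → K) (k : ℕ) :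
    (Kr K Finset.univ (w K N N q) k).map (Pm K (n := N) M).toLinearMap ≤ Kr K Finset.univ (w K N N q) k := by
  rintro _ ⟨θ, hθ, rfl⟩
  exact Pm_mem_Kr_w K M q hθ

/-- submodule form: **`Pm M (V(univ, w_N q, k)) ≤ V(univ, w_N q, k)`** for every `M`. -/
theorem map_Pm_V_w_le (M : Matrix (Fin N) (Fin N) K) (q : ℕ → K) (k : ℕ) :
    (V K (In N) Finset.univ (w K N N q) k).map (Pm K (n := N) M).toLinearMap ≤ V K (In N) Finset.univ (w K N N q) k := by
  rintro _ ⟨v, hv, rfl⟩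
  exact Pm_mem_V_w K M q hv

/-- for `det M = 0` the monoid element kills the class but NOT its kernel: `Pm M (w_N q) = 0` (H9b) while `Pm M` still maps `Kr(univ, w_N q, k)` into itself — the two facts are independent. -/
theorem Pm_w_eq_zero_and_mem_Kr {M : Matrix (Fin N) (Fin N) K} (hM : M.det = 0) (q : ℕ → K) {k : ℕ} {θ : HT K (In N)} (hθ : θ ∈ Kr K Finset.univ (w K N N q) k) :
    Pm K M (w K N N q) = 0 ∧ Pm K M θ ∈ Kr K Finset.univ (w K N N q) k :=
  ⟨Pm_w_eq_zero_of_det_eq_zero K hM q, Pm_mem_Kr_w K M q hθ⟩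

end Summit.Ventures.HSemireg.Wedge.HankelPairMixing
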